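import Summits.QuantumFields.YangMills.Theorems.BalabanUVNodesK2NamedJetsLimit
import Summits.QuantumFields.BalabanUV.Gaps.D1PinnedColourPolynomial
import Summits.QuantumFields.BalabanUV.Gaps.D1PinnedFiniteDecision
import Mathlib.Algebra.MvPolynomial.Funext

/-!
# Crux K2⁷ `EndpointGivenBR13SepCoPH` (stmt-QuantumFields-20543) — THE PRICE OF THE DEALT ROAD «(D1) AT EVERY COLOUR DATUM» FOR THE REGISTERED (D1) STUB
# `stub_d1AnchoredJets13 : D1AtAnchoredJets` (skeleton v6 `5a75a2378c79b303`), IN THE KERNEL: the use form `d1AtAnchoredJets_of_d1Drift_all` BY ITS NAME; 1ᴬ's conclusion at a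
# colour datum as ONE QUARTIC EQUATION in the datum (g1-p1's normal form read for DEF-1's `beta0OfJs`); what «all κ» would force (border-weight response, position-table response
# AND the colour quartic all vanish); and the FINITE form of the hypothesis per family (382 named members)

Cell `ym-nodeO-ideate`, seat `ym-nodeO-d1-w2` (explicit unit; director-ym R399 (3a) ∕ №25 (3) «land `stub_d1AnchoredJets13` via `d1AtAnchoredJets_of_d1Drift_all`, coordinate with
the (D1) desks per №206»; dag-lead GATE v1.57 DEAL ∕ WIDTH-207 «first CLAIM takes the pen [= seat `ym-nodeO-d1-w1`, GATE v1.62], the other seat takes `d1AtAnchoredJets_of_d1Drift_all`'s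
drift inputs»; scope agreed with `ym-nodeO-d1-w1` (D1W1-COORD-1): the PORT-2 junctions of the crux idea «corner-limit-sign» §9 — hypothesis-free convergence, «drift ⟺ `lim = stepBal`»,
1ᴬ located, the merged ∃κ text, the sign edition — are THAT seat's `Theorems/BalabanUVNodesK2NamedJetsLimit` (p607079), IMPORTED here and used BY NAME (`drift_iff_lim_eq`,
`d1DriftAll_iff_colourBlind`); THIS file is the non-overlapping piece).  `--kind proof --supports
stmt-QuantumFields-20543 --as helper`; count-neutral.  0 `def`: every text INLINE or BY NAME (`K2V6Defs.D1AtAnchoredJets`, DEF-1 p603331).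

THE POINT.  The registered 1ᴬ text `K2V6Defs.D1AtAnchoredJets` asks, at every tuple under the crux's prefix and every colour datum `κ : StepColourData` whose `θ.cβ`-scaled named numbers
anchor the record, `∃ A, OneLoopDrift (stepBal 2 F.L) A (beta0OfJs F κ)`.  The skeleton's and the director's use form for it, `d1AtAnchoredJets_of_d1Drift_all`, has the hypothesis
«that drift at EVERY family and EVERY colour datum» (the skeleton's own docstring, v6 :369: «NOT a road — (D1) is ONE quartic equation in the colour data»).  This file puts the name
in the tree (§2, one line over DEF-1's `d1AtAnchoredJets_of_drift_of_anchor`) TOGETHER WITH ITS PRICE as kernel statements: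
* §1 — by g1-p1's universal normal form (`Gaps.D1PinnedColourPolynomial.d1Drift_ctr_iff_normalForm` ∕ `lim_normalForm_universal`, hypothesis-free, at the centred literal that DEF-1's
  `JsOfRecord` ∕ `beta0OfJs` unfold to by `rfl`): for every family there are ONE real polynomial `Φ` in the colour triple (total degree ≤ 4, NO linear part, NO constant), ONE ℝ-linear
  functional `Λ` of an3's position table and two numbers `γ, σ` with — for every numeral `N` and EVERY `κ = (cE, cVH, cΛ; cB; Tc)` —
  `(∃ A, OneLoopDrift (stepBal N F.L) A (beta0OfJs F κ)) ⟺ γ + Φ(cE, cVH, cΛ) + cB·σ + Λ(Tc) = stepBal N F.L` (★ `drift_beta0OfJs_iff_normalForm`; `lim_beta0OfJs_normalForm`); and the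
  `rfl`-grade converter to the β sub-cell's WALL letter `D1Drift F.L (JsBalAn1 … (ctrOff_mem_box …) … F.L^8 …) N 0 1` (BETA∕WALL.md v2.21) — a (D1)-desk theorem in that currency
  closes 1ᴬ's conclusion at κ by `exact` (`drift_beta0OfJs_iff_d1Drift_JsBalAn1`).
* §3 — ★★ `normalForm_trivial_of_limColourBlind`: if ANY such representation `lim (beta0OfJs F κ) = γ + Φ(c⃗) + κ.cB·σ + Λ κ.Tc` (`Φ(0) = 0`) holds and the limit is ONE constant `s` on
  all of `StepColourData`, then `σ = 0 ∧ Λ = 0 ∧ Φ = 0 ∧ γ = s` (four evaluations + `MvPolynomial.funext` over the infinite field ℝ).  Hence (★ `normalForm_trivial_of_d1DriftAll`) the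
  dealt road's hypothesis asserts, for EVERY family: Bałaban's one-loop limit ignores the border weight (`σ = 0`), ignores an3's Wilson two-bond position table (`Λ = 0`), ignores
  the first-order colour triple (`Φ = 0`), and the PURE-TADPOLE member `κ = 0` alone carries the asymptotic-freedom slope (`γ = stepBal 2 F.L`; `lim_zeroColour_eq_of_d1DriftAll` — the
  member whose `γ` CRIT-2 ROUND 4 found UNCOMPUTED in `Gaps.D1PinnedColourFreeCore`).  NONE of this is certified either way (0 coefficients computed in the tree); it is the price tag.
* §4 — ★ `d1DriftAllAt_iff_members382`: per family, «(D1) at EVERY colour datum» ⟺ «(D1) at 382 NAMED members» — the 125 unit-grid colour triples `⟨i, j, k, 0, 0⟩` (`i, j, k ≤ 4`),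
  the border member `⟨0, 0, 0, 1, 0⟩`, the 256 `Module.finBasis` position tables `⟨0, 0, 0, 0, b i⟩` (g1-p1 GEN 12's `Gaps.D1PinnedFiniteDecision.d1Drift_of_members382` at
  `Lc := F.L`, root `ctrOff`) — so the hypothesis of `d1AtAnchoredJets_of_d1Drift_all` at family `F` is a FINITE list of 382 real identities `lim = stepBal 2 F.L` (target list for the
  beta-num ∕ kit desks; ANY ONE certified member off the variety refutes it — seat d1-w1's `not_d1DriftAll_of_lim_ne`).

HONEST FRAMING.  [folklore] bookkeeping + elementary real algebra over tree theorems BY NAME (DEF-1's `K2V6Defs` ∕ `K2JsOfRecord`; cell pub-balaban-gaps' `CapTailPinnedLimitSign` ∕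
`D1PinnedColourPolynomial` ∕ `D1PinnedFiniteDecision`; the β sub-cell's `Beta.Drift` ∕ `MixedJetTablesPlug`).  NOTHING of Bałaban's analysis is asserted; NO coefficient (`γ, σ, Φ, Λ`, any
limit) is computed or signed; (D1) is NOT discharged at any colour datum; `stub_d1AnchoredJets13` ∕ `stub_runRemNamedJets13` ∕ K2⁷ are NOT proved (every implication has an unproved — and,
for the «all κ» forms, not expected — hypothesis shape on the left; instance 0∕1); (P6) — which κ is print's — NOT decided; the skeleton v6 is untouched and nothing is recommended here
(the re-deal of 1ᴬ — CRIT-2 ROUND 4 (a)∕(b) — is the plan's call); counts UNMOVED (typed 28∕28 · discharged 5∕27 (A 5∕28)); [Balaban1987RG1] Thm 2 + (0.31) p. 259 (NODE O) is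
UNPROVED IN PRINT.  Route R4 closes the CONDITIONAL finite-𝕋⁴ rung `BalabanLadder.UV` only — NOT continuum, NOT ℝ⁴, NOT OS, NOT a mass gap; the Clay YM mass gap is NOT proved by any
of this.  No `def`, no `instance`, no `notation`, no `axiom`, 0 `sorry`.  Sources (context only; nothing printed is used as a hypothesis): [I] = [Balaban1987RG1] CMP **109** (1987):
Thm 2 p. 259 (first sentence), (1.3) p. 260, (1.22) p. 264, (2.12)–(2.14) p. 268, (5.9)–(5.10) p. 293.
-/

noncomputable section

namespace Summit.QuantumFields.YangMills.Theorems.BalabanUVNodesK2D1DriftAllPrice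

open Filter Topology
open Literature.MathematicalPhysics.QuantumFieldTheory.Balaban1983to89
open Literature.MathematicalPhysics.QuantumFieldTheory.Balaban1983to89.T4Continuum (T4Family)
open Literature.MathematicalPhysics.QuantumFieldTheory.Balaban1983to89.Beta.Drift (OneLoopDrift)
open Literature.MathematicalPhysics.QuantumFieldTheory.Balaban1983to89.Beta.RateCertificate (CauchyRate)
open Literature.MathematicalPhysics.QuantumFieldTheory.Balaban1983to89.Beta.OneStepKernelFamily (TbalOf D1Drift)
open Literature.MathematicalPhysics.QuantumFieldTheory.Balaban1983to89.Beta.AveragingContoursRooted (ctrOff ctrOff_mem_box)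
open Summit.QuantumFields.BalabanUV.Beta.MixedJetTablesPlug (JsBalAn1 JsBalAn1Ctr)
open Summit.QuantumFields.BalabanUV.Beta.GAN24.StencilSlotOfE3 (one_le_of_two_le)
open Summit.QuantumFields.BalabanUV.Gaps.D1PinnedColourPolynomial (d1Drift_ctr_iff_normalForm lim_normalForm_universal)
open Summit.QuantumFields.BalabanUV.Gaps.D1PinnedFiniteDecision (d1Drift_of_members382)
open Summit.QuantumFields.YangMills.Theorems.BalabanUVNodesK2JsOfRecord (StepColourData JsOfRecord beta0OfJs d1Drift_JsOfRecord_iff)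
open Summit.QuantumFields.YangMills.Theorems.BalabanUVNodesK2V6Defs (D1AtAnchoredJets d1AtAnchoredJets_of_drift_of_anchor)
open Summit.QuantumFields.YangMills.Theorems.BalabanUVNodesK2NamedJetsLimit (drift_iff_lim_eq d1DriftAll_iff_colourBlind)

/-! ## §1 1ᴬ's conclusion at a colour datum: the wall letter (`rfl`), ONE quartic equation in the datum (hypothesis-free normal form) -/

section NormalForm

variable (F : T4Family) (κ : StepColourData)

/-- **CURRENCY CONVERTER FOR THE (D1) DESKS**: 1ᴬ's conclusion at κ IS the β sub-cell's WALL STATEMENT `D1Drift Lc (JsBalAn1 hLc hr cE cVH cΛ cE₂ cB T) N μ ν` (BETA∕WALL.md v2.21)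
read at `Lc := F.L`, root `r := ctrOff (3+1) F.L`, `cE₂ := F.L^8`, channel `(0,1)`, colour data `κ` — DEF-1's `d1Drift_JsOfRecord_iff` ∕ `…_iff_JsBalAn1Ctr` one unfolding further
(`JsBalAn1Ctr = JsBalAn1 … (ctrOff_mem_box …)` by `rfl`): a β-row theorem in that currency closes 1ᴬ's conclusion at that κ by `exact (drift_beta0OfJs_iff_d1Drift_JsBalAn1 F κ 2).mpr h`.
(Under any ambient `NeZero F.L`.) [folklore] -/
theorem drift_beta0OfJs_iff_d1Drift_JsBalAn1 [NeZero F.L] (N : ℝ) :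
    (∃ A : ℝ, OneLoopDrift (B12Normalization.stepBal N F.L) A (beta0OfJs F κ)) ↔
      D1Drift F.L (JsBalAn1 F.hL.2.le (ctrOff_mem_box F.hL.2.le) κ.cE κ.cVH κ.cΛ ((F.L : ℝ) ^ (2 * (3 + 1))) κ.cB κ.Tc) N 0 1 :=
  (d1Drift_JsOfRecord_iff F κ N).symm

/-- **★ 1ᴬ's CONCLUSION AT κ IS ONE QUARTIC EQUATION IN κ — HYPOTHESIS-FREE** (g1-p1's universal normal form `Gaps.D1PinnedColourPolynomial.d1Drift_ctr_iff_normalForm` at the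
centred literal, read for DEF-1's `beta0OfJs`): for every family there are ONE real polynomial `Φ` in the colour triple (total degree ≤ 4, NO linear part, NO constant), ONE ℝ-linear
functional `Λ` of the position table and two numbers `γ, σ` such that, for every numeral `N` and EVERY colour datum `κ = (cE, cVH, cΛ; cB; Tc)`,
`(∃ A, OneLoopDrift (stepBal N F.L) A (beta0OfJs F κ)) ⟺ γ + Φ(cE, cVH, cΛ) + cB·σ + Λ(Tc) = stepBal N F.L`.  NO coefficient is computed or signed. [folklore] -/
theorem drift_beta0OfJs_iff_normalForm (F : T4Family) :
    ∃ (Φ : MvPolynomial (Fin 3) ℝ) (Λ : (Fin 4 → Fin 4 → Fin 4 → Fin 4 → ℝ) →ₗ[ℝ] ℝ) (γ σ : ℝ),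
      Φ.totalDegree ≤ 4 ∧ Φ.homogeneousComponent 1 = 0 ∧ Φ.coeff 0 = 0 ∧
      ∀ (N : ℝ) (κ : StepColourData),
        ((∃ A : ℝ, OneLoopDrift (B12Normalization.stepBal N F.L) A (beta0OfJs F κ)) ↔
          γ + MvPolynomial.eval ![κ.cE, κ.cVH, κ.cΛ] Φ + κ.cB * σ + Λ κ.Tc = B12Normalization.stepBal N F.L) := by
  haveI : NeZero F.L := ⟨by have := F.hL.2; omega⟩
  obtain ⟨Φ, Λ, γ, σ, h4, h1, h0, h⟩ := d1Drift_ctr_iff_normalForm (Lc := F.L) F.hL.2 0 1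
  exact ⟨Φ, Λ, γ, σ, h4, h1, h0, fun N κ => (d1Drift_JsOfRecord_iff F κ N).symm.trans (h N κ.cE κ.cVH κ.cΛ κ.cB κ.Tc)⟩

/-- … and the same normal form for the LIMIT of the named numbers itself (g1-p1's `lim_normalForm_universal` at reference root = root = `ctrOff`; the sequence `beta0OfJs F κ` converges
to `CauchyRate.lim (beta0OfJs F κ)` hypothesis-free — `Gaps.CapTailPinnedLimitSign.tendsto_pinned`, seat d1-w1's `tendsto_beta0OfJs`): for every colour datum
`CauchyRate.lim (beta0OfJs F κ) = γ + Φ(cE, cVH, cΛ) + cB·σ + Λ(Tc)`. [folklore] -/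
theorem lim_beta0OfJs_normalForm (F : T4Family) :
    ∃ (Φ : MvPolynomial (Fin 3) ℝ) (Λ : (Fin 4 → Fin 4 → Fin 4 → Fin 4 → ℝ) →ₗ[ℝ] ℝ) (γ σ : ℝ),
      Φ.totalDegree ≤ 4 ∧ Φ.homogeneousComponent 1 = 0 ∧ Φ.coeff 0 = 0 ∧
      ∀ κ : StepColourData, CauchyRate.lim (beta0OfJs F κ) = γ + MvPolynomial.eval ![κ.cE, κ.cVH, κ.cΛ] Φ + κ.cB * σ + Λ κ.Tc := by
  haveI : NeZero F.L := ⟨by have := F.hL.2; omega⟩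
  obtain ⟨Φ, Λ, h4, h1, h0, h⟩ := lim_normalForm_universal (Lc := F.L) F.hL.2 (ctrOff_mem_box (d := 3 + 1) F.hL.2.le) 0 1
  obtain ⟨γ, σ, hγ⟩ := h (ctrOff (3 + 1) F.L) (ctrOff_mem_box F.hL.2.le)
  exact ⟨Φ, Λ, γ, σ, h4, h1, h0, fun κ => hγ κ.cE κ.cVH κ.cΛ κ.cB κ.Tc⟩

end NormalForm

/-! ## §2 The use form `d1AtAnchoredJets_of_d1Drift_all` BY ITS NAME (and in the wall currency) -/

section UseForm

/-- **THE USE FORM OF RECORD, BY ITS NAME** (director-ym R399 (3a); dag-lead GATE v1.57 ∕ NODE-TABLE «use form `d1AtAnchoredJets_of_d1Drift_all`»; the v3 ∕ v6 :369 hypothesis):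
«(D1) at EVERY colour datum of EVERY family», `∀ F κ, ∃ A, OneLoopDrift (stepBal 2 F.L) A (beta0OfJs F κ)` ⟹ `K2V6Defs.D1AtAnchoredJets` — DEF-1's `d1AtAnchoredJets_of_drift_of_anchor`
with the anchor (and θ) discarded.  HONEST LABEL: the hypothesis is NOT a road (v6 :369; §3 states what it would force, §4 its finite form per family; seat d1-w1's
`d1DriftAll_iff_colourBlind`: it is total colour-blindness of the one-loop limit); recorded so that the name the desks' tables cite EXISTS in the tree with its price beside it. [folklore] -/
theorem d1AtAnchoredJets_of_d1Drift_all
    (h : ∀ (F : T4Family) (κ : StepColourData), ∃ A : ℝ, OneLoopDrift (B12Normalization.stepBal 2 F.L) A (beta0OfJs F κ)) :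
    D1AtAnchoredJets :=
  d1AtAnchoredJets_of_drift_of_anchor fun F κ _ _ _ _ => h F κ

/-- The same use form in the β sub-cell's WALL currency: `D1Drift F.L (JsBalAn1 … (ctrOff_mem_box …) κ… F.L^8 …) 2 0 1` at every family and colour datum ⟹ 1ᴬ (§1's converter).
Same honest label. [folklore] -/
theorem d1AtAnchoredJets_of_d1DriftWall_all
    (h : ∀ (F : T4Family) [NeZero F.L] (κ : StepColourData),
      D1Drift F.L (JsBalAn1 F.hL.2.le (ctrOff_mem_box F.hL.2.le) κ.cE κ.cVH κ.cΛ ((F.L : ℝ) ^ (2 * (3 + 1))) κ.cB κ.Tc) 2 0 1) :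
    D1AtAnchoredJets :=
  d1AtAnchoredJets_of_d1Drift_all fun F κ => by
    haveI : NeZero F.L := ⟨by have := F.hL.2; omega⟩
    exact (drift_beta0OfJs_iff_d1Drift_JsBalAn1 F κ 2).mpr (h F κ)

end UseForm

/-! ## §3 THE PRICE: «(D1) at every colour datum» forces the border-weight response, the position-table response AND the colour quartic to vanish -/

section Price

/-- **★★ THE PRICE OF TOTAL COLOUR-BLINDNESS, AS A KERNEL STATEMENT** (elementary algebra on ANY normal form with `Φ(0) = 0`; applies to g1-p1's by `lim_beta0OfJs_normalForm`): if
`CauchyRate.lim (beta0OfJs F κ) = γ + Φ(κ.cE, κ.cVH, κ.cΛ) + κ.cB·σ + Λ(κ.Tc)` for all κ and the limit is the constant `s` on all of `StepColourData`, then the border-weight response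
VANISHES (`σ = 0`), the position-table response VANISHES (`Λ = 0`), the colour polynomial VANISHES IDENTICALLY (`Φ = 0`, `MvPolynomial.funext` over the infinite field ℝ) and `γ = s` —
the one-loop limit would ignore the border weight, an3's Wilson two-bond position table AND the first-order colour triple entirely.  Nothing here says whether that is so
(0 coefficients certified); it is what the «all κ» road ASSERTS. [folklore] -/
theorem normalForm_trivial_of_limColourBlind {F : T4Family} {Φ : MvPolynomial (Fin 3) ℝ} {Λ : (Fin 4 → Fin 4 → Fin 4 → Fin 4 → ℝ) →ₗ[ℝ] ℝ} {γ σ s : ℝ}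
    (h0 : Φ.coeff 0 = 0)
    (hnf : ∀ κ : StepColourData, CauchyRate.lim (beta0OfJs F κ) = γ + MvPolynomial.eval ![κ.cE, κ.cVH, κ.cΛ] Φ + κ.cB * σ + Λ κ.Tc)
    (hblind : ∀ κ : StepColourData, CauchyRate.lim (beta0OfJs F κ) = s) :
    σ = 0 ∧ Λ = 0 ∧ Φ = 0 ∧ γ = s := by
  -- read the normal form at the members `(c⃗; cB; Tc)` as equations `γ + Φ(c⃗) + cB σ + Λ Tc = s`
  have hval : ∀ (cE cVH cΛ cB : ℝ) (Tc : Fin 4 → Fin 4 → Fin 4 → Fin 4 → ℝ),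
      γ + MvPolynomial.eval ![cE, cVH, cΛ] Φ + cB * σ + Λ Tc = s := fun cE cVH cΛ cB Tc => by
    have := hnf ⟨cE, cVH, cΛ, cB, Tc⟩
    rw [hblind ⟨cE, cVH, cΛ, cB, Tc⟩] at this
    exact this.symm
  -- `Φ(0⃗) = 0` from `Φ.coeff 0 = 0`
  have hΦ0 : MvPolynomial.eval ![(0 : ℝ), 0, 0] Φ = 0 := by
    have e : (![(0 : ℝ), 0, 0] : Fin 3 → ℝ) = 0 := by
      funext i; fin_cases i <;> rfl
    rw [e, MvPolynomial.eval_zero, MvPolynomial.constantCoeff_eq, h0]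
  -- the pure-tadpole member `(0⃗; 0; 0)`: `γ = s`
  have hγ : γ = s := by
    have := hval 0 0 0 0 0
    simp only [hΦ0, map_zero, add_zero, zero_mul] at this
    exact this
  -- the border member `(0⃗; 1; 0)`: `σ = 0`
  have hσ : σ = 0 := by
    have := hval 0 0 0 1 0
    simp only [hΦ0, map_zero, add_zero, one_mul] at this
    linarith
  -- the table members `(0⃗; 0; Tc)`: `Λ = 0`
  have hΛ : Λ = 0 := by
    refine LinearMap.ext fun Tc => ?_
    have := hval 0 0 0 0 Tc
    simp only [hΦ0, add_zero, zero_mul] at this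
    rw [LinearMap.zero_apply]
    linarith
  -- the colour members `(c⃗; 0; 0)`: `Φ ≡ 0` as a function, hence `Φ = 0` as a polynomial (ℝ infinite)
  have hΦ : Φ = 0 := by
    refine MvPolynomial.funext fun x => ?_
    have := hval (x 0) (x 1) (x 2) 0 0
    have ex : (![x 0, x 1, x 2] : Fin 3 → ℝ) = x := by
      funext i; fin_cases i <;> rfl
    rw [ex] at this
    simp only [map_zero, add_zero, zero_mul] at this
    rw [map_zero]
    linarith
  exact ⟨hσ, hΛ, hΦ, hγ⟩

/-- **★ COROLLARY: WHAT THE DEALT ROAD ASSERTS OF BAŁABAN's ONE-LOOP LIMIT, per family** — under the hypothesis of `d1AtAnchoredJets_of_d1Drift_all`, every normal-form datum of EVERY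
family is trivial: `σ = 0 ∧ Λ = 0 ∧ Φ = 0 ∧ γ = stepBal 2 F.L` (for ANY normal form with `Φ(0) = 0` representing the limit — one exists, `lim_beta0OfJs_normalForm`).  The «all κ» drift
gives «lim ≡ stepBal 2 F.L» by seat d1-w1's `d1DriftAll_iff_colourBlind` (g1-p3's hypothesis-free `d1Drift_pinned_iff_lim_eq` pointwise).  Uncertified either way; recorded as the road's price.
[folklore] -/
theorem normalForm_trivial_of_d1DriftAll
    (h : ∀ (F : T4Family) (κ : StepColourData), ∃ A : ℝ, OneLoopDrift (B12Normalization.stepBal 2 F.L) A (beta0OfJs F κ))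
    (F : T4Family) {Φ : MvPolynomial (Fin 3) ℝ} {Λ : (Fin 4 → Fin 4 → Fin 4 → Fin 4 → ℝ) →ₗ[ℝ] ℝ} {γ σ : ℝ} (h0 : Φ.coeff 0 = 0)
    (hnf : ∀ κ : StepColourData, CauchyRate.lim (beta0OfJs F κ) = γ + MvPolynomial.eval ![κ.cE, κ.cVH, κ.cΛ] Φ + κ.cB * σ + Λ κ.Tc) :
    σ = 0 ∧ Λ = 0 ∧ Φ = 0 ∧ γ = B12Normalization.stepBal 2 F.L :=
  normalForm_trivial_of_limColourBlind h0 hnf (d1DriftAll_iff_colourBlind.mp h F)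

/-- **THERE IS SUCH A NORMAL FORM, so the corollary is not vacuous**: under the hypothesis of `d1AtAnchoredJets_of_d1Drift_all`, for every family there EXIST `Φ, Λ, γ, σ` as in §1 which are
ALL trivial AND represent the limit — i.e. `CauchyRate.lim (beta0OfJs F κ) = stepBal 2 F.L` is then the WHOLE one-loop content at every colour datum. [folklore] -/
theorem exists_trivial_normalForm_of_d1DriftAll
    (h : ∀ (F : T4Family) (κ : StepColourData), ∃ A : ℝ, OneLoopDrift (B12Normalization.stepBal 2 F.L) A (beta0OfJs F κ)) (F : T4Family) :
    ∃ (Φ : MvPolynomial (Fin 3) ℝ) (Λ : (Fin 4 → Fin 4 → Fin 4 → Fin 4 → ℝ) →ₗ[ℝ] ℝ) (γ σ : ℝ),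
      (∀ κ : StepColourData, CauchyRate.lim (beta0OfJs F κ) = γ + MvPolynomial.eval ![κ.cE, κ.cVH, κ.cΛ] Φ + κ.cB * σ + Λ κ.Tc) ∧
      σ = 0 ∧ Λ = 0 ∧ Φ = 0 ∧ γ = B12Normalization.stepBal 2 F.L := by
  obtain ⟨Φ, Λ, γ, σ, -, -, h0, hnf⟩ := lim_beta0OfJs_normalForm F
  exact ⟨Φ, Λ, γ, σ, hnf, normalForm_trivial_of_d1DriftAll h F h0 hnf⟩

/-- … read at ONE member: under the «all κ» hypothesis the PURE-TADPOLE member `κ = ⟨0, 0, 0, 0, 0⟩` (no colour, no border, no position table; cell pub-balaban-gaps'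
`D1PinnedColourFreeCore`) ALONE carries the asymptotic-freedom slope, `CauchyRate.lim (beta0OfJs F ⟨0, 0, 0, 0, 0⟩) = stepBal 2 F.L` — the member CRIT-2 ROUND 4 examined for a kernel
kill (its `γ` is UNCOMPUTED in the tree). [folklore] -/
theorem lim_zeroColour_eq_of_d1DriftAll
    (h : ∀ (F : T4Family) (κ : StepColourData), ∃ A : ℝ, OneLoopDrift (B12Normalization.stepBal 2 F.L) A (beta0OfJs F κ)) (F : T4Family) :
    CauchyRate.lim (beta0OfJs F ⟨0, 0, 0, 0, 0⟩) = B12Normalization.stepBal 2 F.L :=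
  d1DriftAll_iff_colourBlind.mp h F _

end Price

/-! ## §4 The FINITE form of the hypothesis per family: 382 named members decide «(D1) at every colour datum» -/

section Finite

/-- **★ PER FAMILY, «(D1) AT EVERY COLOUR DATUM» ⟺ «(D1) AT 382 NAMED MEMBERS»** (g1-p1 GEN 12's `Gaps.D1PinnedFiniteDecision.d1Drift_of_members382` at `Lc := F.L`, root `ctrOff`,
numeral 2, channel `(0,1)`, keyed to DEF-1's `beta0OfJs F ⟨cE, cVH, cΛ, cB, Tc⟩` by `rfl`): the 125 unit-grid colour members `⟨i, j, k, 0, 0⟩` (`i, j, k ∈ {0,…,4}`), the ONE border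
member `⟨0, 0, 0, 1, 0⟩`, and the 256 position-table members `⟨0, 0, 0, 0, b i⟩` for Mathlib's `Module.finBasis` `b` of `Fin 4 → Fin 4 → Fin 4 → Fin 4 → ℝ`.  So the hypothesis of
`d1AtAnchoredJets_of_d1Drift_all` at family `F` is a FINITE list of 382 real identities `CauchyRate.lim (beta0OfJs F ·) = stepBal 2 F.L` (seat d1-w1's `drift_iff_lim_eq`) — a target
LIST for a certificate engine; conversely ANY ONE certified member off the variety refutes the road.  Which members satisfy (D1) is print's UNCOMPUTED data; nothing decided here. [folklore] -/
theorem d1DriftAllAt_iff_members382 (F : T4Family) :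
    (∀ κ : StepColourData, ∃ A : ℝ, OneLoopDrift (B12Normalization.stepBal 2 F.L) A (beta0OfJs F κ)) ↔
      ((∀ i j k : ℕ, i ≤ 4 → j ≤ 4 → k ≤ 4 →
          ∃ A : ℝ, OneLoopDrift (B12Normalization.stepBal 2 F.L) A (beta0OfJs F ⟨i, j, k, 0, 0⟩)) ∧
        (∃ A : ℝ, OneLoopDrift (B12Normalization.stepBal 2 F.L) A (beta0OfJs F ⟨0, 0, 0, 1, 0⟩)) ∧
        (∀ i, ∃ A : ℝ, OneLoopDrift (B12Normalization.stepBal 2 F.L) A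
          (beta0OfJs F ⟨0, 0, 0, 0, Module.finBasis ℝ (Fin 4 → Fin 4 → Fin 4 → Fin 4 → ℝ) i⟩))) := by
  haveI : NeZero F.L := ⟨by have := F.hL.2; omega⟩
  refine ⟨fun h => ⟨fun i j k _ _ _ => h _, h _, fun i => h _⟩, fun ⟨hgrid, hborder, htab⟩ κ => ?_⟩
  refine (d1Drift_JsOfRecord_iff F κ 2).mp ?_
  refine d1Drift_of_members382 (Lc := F.L) F.hL.2 (ctrOff_mem_box F.hL.2.le) 0 0 0 0 1 2 ?_ ?_ ?_ κ.cE κ.cVH κ.cΛ κ.cB κ.Tc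
  · intro i j k hi hj hk
    rw [zero_add, zero_add, zero_add]
    exact (d1Drift_JsOfRecord_iff F ⟨i, j, k, 0, 0⟩ 2).mpr (hgrid i j k hi hj hk)
  · exact (d1Drift_JsOfRecord_iff F ⟨0, 0, 0, 1, 0⟩ 2).mpr hborder
  · exact fun i => (d1Drift_JsOfRecord_iff F ⟨0, 0, 0, 0, _⟩ 2).mpr (htab i)

/-- … hence a FINITE use form: (D1) at the 382 named members of EVERY family ⟹ 1ᴬ (through `d1AtAnchoredJets_of_d1Drift_all`; same honest label — a certificate road only if the 382·(every L)
identities were true, which nothing in the tree indicates). [folklore] -/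
theorem d1AtAnchoredJets_of_members382_all
    (h : ∀ F : T4Family,
      (∀ i j k : ℕ, i ≤ 4 → j ≤ 4 → k ≤ 4 → ∃ A : ℝ, OneLoopDrift (B12Normalization.stepBal 2 F.L) A (beta0OfJs F ⟨i, j, k, 0, 0⟩)) ∧
        (∃ A : ℝ, OneLoopDrift (B12Normalization.stepBal 2 F.L) A (beta0OfJs F ⟨0, 0, 0, 1, 0⟩)) ∧
        (∀ i, ∃ A : ℝ, OneLoopDrift (B12Normalization.stepBal 2 F.L) A
          (beta0OfJs F ⟨0, 0, 0, 0, Module.finBasis ℝ (Fin 4 → Fin 4 → Fin 4 → Fin 4 → ℝ) i⟩))) :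
    D1AtAnchoredJets :=
  d1AtAnchoredJets_of_d1Drift_all fun F => (d1DriftAllAt_iff_members382 F).mpr (h F)

end Finite

end Summit.QuantumFields.YangMills.Theorems.BalabanUVNodesK2D1DriftAllPrice

end
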